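import Summits.HodgeConjecture.CorCM.MultiFieldWeilNonIsomorphicSextics
import Summits.HodgeConjecture.CorCM.SexticCMThreefoldPairPowersHodgeOfMarkman
import Summits.HodgeConjecture.CorCM.SexticCMThreefoldCurvePowersHodgeOfMarkman
import Summits.HodgeConjecture.CorCM.SexticOcticWeilJointTransitive
import Summits.HodgeConjecture.CorCM.QuarticCMTypeReflection
import Summits.HodgeConjecture.CorCM.QuadraticCMTypeSlice
import Literature.AlgebraicGeometry.Motives.AbelianVarietyIsogenyCancellation
import HarnessLib

/-!
# MULTI-FIELD WEIL ENGINE — ANY TWO SIMPLE CM ABELIAN THREEFOLDS WHOSE CM FIELDS CONTAIN `k`: the Hodge conjecture for every product of copies of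
# `E`, `T₀`, `T₁`, given ONLY Markman's fourfold theorem (assembly: non-isomorphic fields ∕ one field two types ∕ isogenous)

Cell `pub-hodgecm2` (COR-CM), seat b30 gen 31 (2026-08-24); count-neutral own lane MULTI-FIELD WEIL ENGINE (stem `MultiFieldWeil*`), sequel of
`CorCM/MultiFieldWeilNonIsomorphicSextics.lean`.  Theorems only; no definition, no named fact, no `sorry`.  HONEST FRAMING: conditional on the displayed Markman
fourfold binder only; `HC_CM` is NOT proved and not asserted.

THE ASSEMBLY.  `k` imaginary quadratic, `E ⊨ (k; Ψ)` its CM elliptic curve, `T₀ ⊨ (K₀; Φ₀)`, `T₁ ⊨ (K₁; Φ₁)` SIMPLE abelian threefolds with CM by sextic CM fields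
`K₀ ⊇ i₀(k)`, `K₁ ⊇ i₁(k)`.  Then the Hodge conjecture holds for `⨁_j ![E, T₀, T₁] (κ j)` for EVERY `κ : Fin N → Fin 3` — every `E^a × T₀^b × T₁^c` — and for
everything such a product dominates, GIVEN ONLY `Markman2025_weilClasses_algebraic_abelianFourfold`
(**`hodgeConjectureFor_biproduct_comp_vec_of_two_simpleThreefolds_of_markman`**).  Three cases, all BY NAME:
* `Hom(K₁, K₀) = ∅` (non-isomorphic fields, Galois or not): gen 31's `hodgeConjectureFor_biproduct_comp_of_two_sextics_of_isEmpty` (the cubic-has-a-root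
  lemma), after normalising each threefold structure to ONE member over `τ ∈ Ψ` (a simple threefold's type is not induced from `k`:
  `DihedralSexticPair.exists_mem_comp_ne_of_isSimple`, so it has one or two members over `τ`, `…card_fibre_mem_eq_one_or_two`; two ↦ one by the conjugate
  structure, `IsCMTypeRealisation.transport` along `c_K`, `SexticOcticWeil.card_filter_cmTypeMap_complexConj`) — §1–§2;
* `K₁ ≅ K₀` (a homomorphism between sextic fields is an isomorphism) and `T₀ ≁ T₁`: transport `T₁` to a realisation of a type of `K₀` and apply gen 15's
  `SexticCMThreefoldPair.hodgeConjectureFor_biproduct_comp_vec_of_markman` (one field, two non-isogenous simple threefolds);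
* `T₀ ∼ T₁`: the product of copies is isogenous to a product of copies of `E`, `T₀` (`AbelianVariety.IsIsogenous.biproduct`), covered by gen 15's
  `SexticCMThreefold.hodgeConjectureFor_biproduct_comp_vec_of_markman`; isogenous varieties dominate each other.
With b16's UNCONDITIONAL `Summit.HodgeConjecture.CorCM.hodgeConjectureFor_prod_simpleThreefolds` (`CorCM/SimpleCMThreefoldPairsHodge.lean`) (sextic CM fields sharing NO imaginary quadratic subfield) this covers
every pair of simple CM abelian threefolds: unconditionally when the fields share no imaginary quadratic field, modulo Markman's fourfold theorem (with the CM
curve of the shared field thrown in) when they do.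

[cite: Markman2025SurveySecant, Thm. 1.2] [cite: Shimura1998, §8.2 Prop. 26, §8.4, §18.2 Lemma (i)] [cite: Lang2002, V §1 Prop. 1.2, VI §1 Thm. 1.1]
[cite: MumfordAV1970, §19 Thm. 1 and p. 169]

## References
* [Markman2025SurveySecant] E. Markman, arXiv:2509.23403, Thm. 1.2.  [Shimura1998] G. Shimura, *Abelian varieties with complex multiplication and modular
  functions*, §8.2 Prop. 26, §8.4, §18.2.  [Lang2002] S. Lang, *Algebra*, GTM 211, V §1, VI §1.  [MumfordAV1970] D. Mumford, *Abelian Varieties*, §19.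
-/

noncomputable section

open CategoryTheory CategoryTheory.Limits NumberField IntermediateField

namespace Summit.HodgeConjecture.CorCM.MultiFieldWeil

open Finset
open Literature.AlgebraicGeometry Literature.AlgebraicGeometry.Motives Literature.AlgebraicGeometry.HodgeTheory
open Literature.AlgebraicGeometry.ComplexMultiplication (IsCMTypeRealisation)
open Literature.AlgebraicTopology.SingularHomology
open Literature.NumberTheory.ComplexMultiplication

open scoped Classical

variable {k K₀ K₁ : Type} [Field k] [NumberField k] [IsCMField k] [Field K₀] [NumberField K₀] [IsCMField K₀]
  [Field K₁] [NumberField K₁] [IsCMField K₁] {N : ℕ}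
  {E T₀ T₁ : AbelianVariety ℂ} {Ψ : CMType k} {Φ₀ : CMType K₀} {Φ₁ : CMType K₁}
  {ιE : 𝓞 k →+* End E} {θE : k →+* Module.End ℂ (complexBetti E.X 1)}
  {ι₀ : 𝓞 K₀ →+* End T₀} {θ₀ : K₀ →+* Module.End ℂ (complexBetti T₀.X 1)}
  {ι₁ : 𝓞 K₁ →+* End T₁} {θ₁ : K₁ →+* Module.End ℂ (complexBetti T₁.X 1)}

/-! ## §1 Non-isomorphic fields, `vec` form: both types with one member over `τ` -/

/-- **TWO `(1,2)`-THREEFOLDS OVER NON-ISOMORPHIC SEXTIC CM FIELDS — `vec` form.**  `k` imaginary quadratic, `E ⊨ (k; Ψ)` with `τ ∈ Ψ`; `T_m ⊨ (K_m; Φ_m)` over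
sextic CM fields `K_m ⊇ i_m(k)` with exactly one member of `Φ_m` over `τ`, and `Hom(K₁, K₀) = ∅`.  Then the Hodge conjecture holds for `⨁_j ![E, T₀, T₁] (κ j)` for
every `κ`, GIVEN ONLY Markman's fourfold theorem (gen 31's `hodgeConjectureFor_biproduct_comp_of_two_sextics_of_isEmpty` on the family `(k, K₀, K₁)`).
`HC_CM` is NOT asserted. [cite: Markman2025SurveySecant, Thm. 1.2] [cite: Lang2002, V §1 Prop. 1.2, VI §1 Thm. 1.1] -/
theorem hodgeConjectureFor_biproduct_comp_vec_of_two_sextics_of_isEmpty (hW4 : Markman2025_weilClasses_algebraic_abelianFourfold)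
    (h2 : Module.finrank ℚ k = 2) (h6₀ : Module.finrank ℚ K₀ = 6) (h6₁ : Module.finrank ℚ K₁ = 6) (i₀ : k →+* K₀) (i₁ : k →+* K₁)
    (hE : IsCMTypeRealisation Ψ E ιE θE) (hT₀ : IsCMTypeRealisation Φ₀ T₀ ι₀ θ₀) (hT₁ : IsCMTypeRealisation Φ₁ T₁ ι₁ θ₁)
    {τ : k →+* ℂ} (hτΨ : τ ∈ Ψ.1)
    (h1₀ : (Finset.univ.filter fun s : K₀ →+* ℂ => s.comp i₀ = τ ∧ s ∈ Φ₀.1).card = 1)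
    (h1₁ : (Finset.univ.filter fun s : K₁ →+* ℂ => s.comp i₁ = τ ∧ s ∈ Φ₁.1).card = 1)
    (hK : IsEmpty (K₁ →+* K₀)) (κ : Fin N → Fin 3) :
    HodgeConjectureFor (⨁ fun j => (![E, T₀, T₁] : Fin 3 → AbelianVariety ℂ) (κ j)).dim
      (⨁ fun j => (![E, T₀, T₁] : Fin 3 → AbelianVariety ℂ) (κ j)).X := by
  have hττ : ComplexEmbedding.conjugate τ ≠ τ := QuarticCM.conjugate_ne τ
  have hk : ∀ σ : k →+* ℂ, σ = τ ∨ σ = ComplexEmbedding.conjugate τ := fun σ => QuarticCM.eq_or_eq_conjugate_of_quadratic h2 τ σ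
  have hΨ : ∀ σ : k →+* ℂ, σ ∈ Ψ.1 ↔ σ = τ := by
    intro σ
    rcases hk σ with rfl | rfl
    · exact ⟨fun _ => rfl, fun _ => hτΨ⟩
    · exact ⟨fun h => absurd h ((Ψ.2 τ).1 hτΨ), fun h => absurd h hττ⟩
  -- the family of fields `(k, K₀, K₁)` with its instances (all identifications below are definitional)
  let Kf : Fin 3 → Type := Fin.cons k (Fin.cons K₀ (Fin.cons K₁ finZeroElim))
  letI instF : ∀ j, Field (Kf j) := Fin.cons ‹Field k› (Fin.cons ‹Field K₀› (Fin.cons ‹Field K₁› finZeroElim))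
  letI instN : ∀ j, NumberField (Kf j) := Fin.cons ‹NumberField k› (Fin.cons ‹NumberField K₀› (Fin.cons ‹NumberField K₁› finZeroElim))
  haveI instC : ∀ j, IsCMField (Kf j) := Fin.cons ‹IsCMField k› (Fin.cons ‹IsCMField K₀› (Fin.cons ‹IsCMField K₁› finZeroElim))
  let Φf : ∀ j : Fin 3, CMType (Kf (mfSlots (0 : Fin 3) Fin.succ j)) := Fin.cons Ψ (Fin.cons Φ₀ (Fin.cons Φ₁ finZeroElim))
  let ιf : ∀ j : Fin 3, 𝓞 (Kf (mfSlots (0 : Fin 3) Fin.succ j)) →+* End ((![E, T₀, T₁] : Fin 3 → AbelianVariety ℂ) j) :=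
    Fin.cons ιE (Fin.cons ι₀ (Fin.cons ι₁ finZeroElim))
  let θf : ∀ j : Fin 3, Kf (mfSlots (0 : Fin 3) Fin.succ j) →+* Module.End ℂ (complexBetti ((![E, T₀, T₁] : Fin 3 → AbelianVariety ℂ) j).X 1) :=
    Fin.cons θE (Fin.cons θ₀ (Fin.cons θ₁ finZeroElim))
  have hA : ∀ j, IsCMTypeRealisation (Φf j) ((![E, T₀, T₁] : Fin 3 → AbelianVariety ℂ) j) (ιf j) (θf j) :=
    Fin.cons hE (Fin.cons hT₀ (Fin.cons hT₁ finZeroElim))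
  let im : ∀ m : Fin 2, Kf 0 →+* Kf (Fin.succ m) := Fin.cons i₀ (Fin.cons i₁ finZeroElim)
  have h6 : ∀ m : Fin 2, Module.finrank ℚ (Kf (Fin.succ m)) = 6 := Fin.forall_fin_two.2 ⟨h6₀, h6₁⟩
  have h1 : ∀ m : Fin 2, (Finset.univ.filter fun s : Kf (Fin.succ m) →+* ℂ => s.comp (im m) = τ ∧ s ∈ (Φf m.succ).1).card = 1 :=
    Fin.forall_fin_two.2 ⟨h1₀, h1₁⟩
  have hK' : IsEmpty (Kf (Fin.succ 1) →+* Kf (Fin.succ 0)) := hK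
  exact hodgeConjectureFor_biproduct_comp_of_two_sextics_of_isEmpty (Kf := Kf) (i₀ := (0 : Fin 3)) (is := Fin.succ)
    (A := (![E, T₀, T₁] : Fin 3 → AbelianVariety ℂ)) (Φ := Φf) (ι := ιf) (θ := θf) hW4 κ h2 h6 im hA hΨ h1 hK'

/-! ## §2 Normalising the number of members over `τ` -/

omit [IsCMField k] in
/-- **A threefold structure with one OR two members over `τ` can be replaced by one with exactly ONE member over `τ` on the SAME variety** (two ↦ the conjugate
structure along complex conjugation of the sextic CM field `K`). [cite: Shimura1998, §18.2 Lemma (i)] -/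
theorem exists_realisation_card_eq_one {K : Type} [Field K] [NumberField K] [IsCMField K] (h6 : Module.finrank ℚ K = 6) (h2 : Module.finrank ℚ k = 2)
    (i : k →+* K) {T : AbelianVariety ℂ} {Φ : CMType K} {ι : 𝓞 K →+* End T} {θ : K →+* Module.End ℂ (complexBetti T.X 1)}
    (hT : IsCMTypeRealisation Φ T ι θ) (τ : k →+* ℂ)
    (h12 : (Finset.univ.filter fun s : K →+* ℂ => s.comp i = τ ∧ s ∈ Φ.1).card = 1 ∨
      (Finset.univ.filter fun s : K →+* ℂ => s.comp i = τ ∧ s ∈ Φ.1).card = 2) :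
    ∃ (Φ' : CMType K) (ι' : 𝓞 K →+* End T) (θ' : K →+* Module.End ℂ (complexBetti T.X 1)),
      IsCMTypeRealisation Φ' T ι' θ' ∧ (Finset.univ.filter fun s : K →+* ℂ => s.comp i = τ ∧ s ∈ Φ'.1).card = 1 := by
  rcases h12 with h | h
  · exact ⟨Φ, ι, θ, hT, h⟩
  · refine ⟨_, _, _, hT.transport (IsCMField.complexConj K).toRingEquiv, ?_⟩
    rw [SexticOcticWeil.card_filter_cmTypeMap_complexConj i τ Φ, SexticOcticWeil.card_filter_comp_eq_of_finrank (n := 3) i (by rw [h6]) h2 τ, h]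

/-- **A SIMPLE threefold structure over a sextic `K ⊇ i(k)` has one or two members over `τ`** (its type is not induced from `k`:
`DihedralSexticPair.exists_mem_comp_ne_of_isSimple`, `…card_fibre_mem_eq_one_or_two`). [cite: Shimura1998, §8.2 Prop. 26 and §8.4] -/
theorem card_filter_mem_eq_one_or_two_of_isSimple {K : Type} [Field K] [NumberField K] [IsCMField K] (h6 : Module.finrank ℚ K = 6)
    (h2 : Module.finrank ℚ k = 2) (i : k →+* K) {T : AbelianVariety ℂ} {Φ : CMType K} {ι : 𝓞 K →+* End T}
    {θ : K →+* Module.End ℂ (complexBetti T.X 1)} (hT : IsCMTypeRealisation Φ T ι θ) (hS : T.IsSimple) (τ : k →+* ℂ) :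
    (Finset.univ.filter fun s : K →+* ℂ => s.comp i = τ ∧ s ∈ Φ.1).card = 1 ∨
      (Finset.univ.filter fun s : K →+* ℂ => s.comp i = τ ∧ s ∈ Φ.1).card = 2 := by
  have hττ : ComplexEmbedding.conjugate τ ≠ τ := QuarticCM.conjugate_ne τ
  have hdich : ∀ s : K →+* ℂ, s.comp i = τ ∨ s.comp i = ComplexEmbedding.conjugate τ := fun s =>
    QuarticCM.eq_or_eq_conjugate_of_quadratic h2 τ (s.comp i)
  rcases DihedralSexticPair.card_fibre_mem_eq_one_or_two hττ hdich h6 (DihedralSexticPair.exists_mem_comp_ne_of_isSimple h6 h2 i hT hS) with h | ⟨h, -⟩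
  · exact Or.inl h
  · exact Or.inr h

omit [IsCMField k] in
/-- **A CM type of an imaginary quadratic field has a member.** [folklore] -/
theorem exists_mem_cmType (Ψ : CMType k) : ∃ τ : k →+* ℂ, τ ∈ Ψ.1 := by
  obtain ⟨σ⟩ : Nonempty (k →+* ℂ) := inferInstance
  by_cases h : σ ∈ Ψ.1
  · exact ⟨σ, h⟩
  · exact ⟨ComplexEmbedding.conjugate σ, (Ψ.2 _).2 (by rw [ComplexEmbedding.involutive_conjugate k σ]; exact h)⟩

/-- **TWO SIMPLE CM THREEFOLDS OVER NON-ISOMORPHIC SEXTIC CM FIELDS CONTAINING `k` — no hypothesis on the types.**  As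
`hodgeConjectureFor_biproduct_comp_vec_of_two_sextics_of_isEmpty` with `T₀`, `T₁` SIMPLE (the one-member normalisation is performed on the structures; the varieties are
unchanged).  `HC_CM` is NOT asserted. [cite: Markman2025SurveySecant, Thm. 1.2] [cite: Shimura1998, §8.2 Prop. 26, §8.4, §18.2 Lemma (i)] -/
theorem hodgeConjectureFor_biproduct_comp_vec_of_two_sextics_of_isSimple_of_isEmpty (hW4 : Markman2025_weilClasses_algebraic_abelianFourfold)
    (h2 : Module.finrank ℚ k = 2) (h6₀ : Module.finrank ℚ K₀ = 6) (h6₁ : Module.finrank ℚ K₁ = 6) (i₀ : k →+* K₀) (i₁ : k →+* K₁)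
    (hE : IsCMTypeRealisation Ψ E ιE θE) (hT₀ : IsCMTypeRealisation Φ₀ T₀ ι₀ θ₀) (hT₁ : IsCMTypeRealisation Φ₁ T₁ ι₁ θ₁)
    (hS₀ : T₀.IsSimple) (hS₁ : T₁.IsSimple) (hK : IsEmpty (K₁ →+* K₀)) (κ : Fin N → Fin 3) :
    HodgeConjectureFor (⨁ fun j => (![E, T₀, T₁] : Fin 3 → AbelianVariety ℂ) (κ j)).dim
      (⨁ fun j => (![E, T₀, T₁] : Fin 3 → AbelianVariety ℂ) (κ j)).X := by
  obtain ⟨τ, hτΨ⟩ := exists_mem_cmType Ψ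
  obtain ⟨Φ₀', ι₀', θ₀', hT₀', h1₀⟩ := exists_realisation_card_eq_one h6₀ h2 i₀ hT₀ τ (card_filter_mem_eq_one_or_two_of_isSimple h6₀ h2 i₀ hT₀ hS₀ τ)
  obtain ⟨Φ₁', ι₁', θ₁', hT₁', h1₁⟩ := exists_realisation_card_eq_one h6₁ h2 i₁ hT₁ τ (card_filter_mem_eq_one_or_two_of_isSimple h6₁ h2 i₁ hT₁ hS₁ τ)
  exact hodgeConjectureFor_biproduct_comp_vec_of_two_sextics_of_isEmpty hW4 h2 h6₀ h6₁ i₀ i₁ hE hT₀' hT₁' hτΨ h1₀ h1₁ hK κ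

/-! ## §3 The assembly: ANY two simple CM threefolds whose sextic CM fields contain `k` -/

omit [IsCMField K₀] [IsCMField K₁] in
/-- A ring homomorphism between number fields of the same degree is an isomorphism. [folklore] -/
theorem exists_ringEquiv_of_ringHom_of_finrank_eq (f : K₁ →+* K₀) (h : Module.finrank ℚ K₁ = Module.finrank ℚ K₀) : Nonempty (K₁ ≃+* K₀) := by
  have hinj : Function.Injective f.toRatAlgHom.toLinearMap := f.injective
  have hsurj : Function.Surjective f.toRatAlgHom.toLinearMap := (LinearMap.injective_iff_surjective_of_finrank_eq_finrank h).1 hinj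
  exact ⟨(AlgEquiv.ofBijective f.toRatAlgHom ⟨hinj, hsurj⟩).toRingEquiv⟩

/-- **MAIN THEOREM — ANY TWO SIMPLE CM ABELIAN THREEFOLDS WHOSE CM FIELDS CONTAIN `k`, given ONLY Markman's fourfold theorem.**  `k` imaginary quadratic,
`E ⊨ (k; Ψ)` a CM elliptic curve, `T₀ ⊨ (K₀; Φ₀)` and `T₁ ⊨ (K₁; Φ₁)` SIMPLE abelian threefolds with CM by sextic CM fields `K₀ ⊇ i₀(k)`, `K₁ ⊇ i₁(k)` — no further
hypothesis (the fields may be isomorphic or not, Galois or not; the threefolds may be isogenous).  Then for every `κ : Fin N → Fin 3` — every product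
`E^a × T₀^b × T₁^c` of copies, in any number and order — every rational `(p,p)`-class on `⨁_j ![E, T₀, T₁] (κ j)` is algebraic, GIVEN ONLY
`Markman2025_weilClasses_algebraic_abelianFourfold`.  Cases: `Hom(K₁,K₀) = ∅` (§2); `K₁ ≅ K₀`, `T₀ ≁ T₁` (transport + `SexticCMThreefoldPair…`); `T₀ ∼ T₁` (isogenous
to a product of copies of `E`, `T₀`: `SexticCMThreefold…`).  `HC_CM` is NOT asserted. [cite: Markman2025SurveySecant, Thm. 1.2]
[cite: Shimura1998, §8.2 Prop. 26, §8.4, §18.2 Lemma (i)] [cite: Lang2002, V §1 Prop. 1.2, VI §1 Thm. 1.1] [cite: MumfordAV1970, §19 Thm. 1 and p. 169] -/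
theorem hodgeConjectureFor_biproduct_comp_vec_of_two_simpleThreefolds_of_markman (hW4 : Markman2025_weilClasses_algebraic_abelianFourfold)
    (h2 : Module.finrank ℚ k = 2) (h6₀ : Module.finrank ℚ K₀ = 6) (h6₁ : Module.finrank ℚ K₁ = 6) (i₀ : k →+* K₀) (i₁ : k →+* K₁)
    (hE : IsCMTypeRealisation Ψ E ιE θE) (hT₀ : IsCMTypeRealisation Φ₀ T₀ ι₀ θ₀) (hT₁ : IsCMTypeRealisation Φ₁ T₁ ι₁ θ₁)
    (hS₀ : T₀.IsSimple) (hS₁ : T₁.IsSimple) (κ : Fin N → Fin 3) :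
    HodgeConjectureFor (⨁ fun j => (![E, T₀, T₁] : Fin 3 → AbelianVariety ℂ) (κ j)).dim
      (⨁ fun j => (![E, T₀, T₁] : Fin 3 → AbelianVariety ℂ) (κ j)).X := by
  by_cases hK : IsEmpty (K₁ →+* K₀)
  · exact hodgeConjectureFor_biproduct_comp_vec_of_two_sextics_of_isSimple_of_isEmpty hW4 h2 h6₀ h6₁ i₀ i₁ hE hT₀ hT₁ hS₀ hS₁ hK κ
  · rw [not_isEmpty_iff] at hK
    obtain ⟨f⟩ := hK
    obtain ⟨e⟩ := exists_ringEquiv_of_ringHom_of_finrank_eq f (by rw [h6₁, h6₀])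
    -- `T₁` as a realisation of a type of `K₀`
    have hT₁' := hT₁.transport e
    by_cases hiso : AbelianVariety.IsIsogenous T₀ T₁
    · -- the product of copies is isogenous to a product of copies of `E`, `T₀`
      let κ' : Fin N → Fin 2 := fun j => (![0, 1, 1] : Fin 3 → Fin 2) (κ j)
      have hY := SexticCMThreefold.hodgeConjectureFor_biproduct_comp_vec_of_markman hW4 h6₀ h2 i₀ hE hT₀ hS₀ κ'
      refine Domination.hodgeConjectureFor_of_avDominatedBy hY
        (Domination.AVDominatedBy.of_isIsogenous (AbelianVariety.IsIsogenous.biproduct fun j => ?_) (Domination.AVDominatedBy.refl _))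
      show AbelianVariety.IsIsogenous ((![E, T₀, T₁] : Fin 3 → AbelianVariety ℂ) (κ j)) ((![E, T₀] : Fin 2 → AbelianVariety ℂ) ((![0, 1, 1] : Fin 3 → Fin 2) (κ j)))
      generalize κ j = c
      fin_cases c
      · exact AbelianVariety.IsIsogenous.refl E
      · exact AbelianVariety.IsIsogenous.refl T₀
      · exact hiso.symm'
    · exact SexticCMThreefoldPair.hodgeConjectureFor_biproduct_comp_vec_of_markman κ hW4 h6₀ h2 i₀ hE hT₀ hT₁' hS₀ hS₁ hiso

/-- **Dominated form: every abelian variety dominated by a product of copies of `E`, `T₀`, `T₁`** — every abelian variety isogenous to some `E^a × T₀^b × T₁^c`,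
every abelian subvariety and quotient of such — satisfies the Hodge conjecture, given only Markman's fourfold theorem. [cite: Markman2025SurveySecant, Thm. 1.2]
[cite: MumfordAV1970, §19 Thm. 1 and p. 169] -/
theorem hodgeConjectureFor_of_avDominatedBy_comp_vec_of_two_simpleThreefolds_of_markman (hW4 : Markman2025_weilClasses_algebraic_abelianFourfold)
    (h2 : Module.finrank ℚ k = 2) (h6₀ : Module.finrank ℚ K₀ = 6) (h6₁ : Module.finrank ℚ K₁ = 6) (i₀ : k →+* K₀) (i₁ : k →+* K₁)
    (hE : IsCMTypeRealisation Ψ E ιE θE) (hT₀ : IsCMTypeRealisation Φ₀ T₀ ι₀ θ₀) (hT₁ : IsCMTypeRealisation Φ₁ T₁ ι₁ θ₁)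
    (hS₀ : T₀.IsSimple) (hS₁ : T₁.IsSimple) (κ : Fin N → Fin 3) {X : AbelianVariety ℂ}
    (hX : Domination.AVDominatedBy X (⨁ fun j => (![E, T₀, T₁] : Fin 3 → AbelianVariety ℂ) (κ j))) :
    HodgeConjectureFor X.dim X.X :=
  Domination.hodgeConjectureFor_of_avDominatedBy
    (hodgeConjectureFor_biproduct_comp_vec_of_two_simpleThreefolds_of_markman hW4 h2 h6₀ h6₁ i₀ i₁ hE hT₀ hT₁ hS₀ hS₁ κ) hX

end Summit.HodgeConjecture.CorCM.MultiFieldWeil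

end
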